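import Summits.NavierStokesRegularity.NavierStokesRegularity.Theses.AxisymmetricExtremality
import Summits.NavierStokesRegularity.NavierStokesRegularity.Theorems.AxisymmetricExtremalityAxisymmetricKatoGlobalNoSwirlStratum
import Summits.NavierStokesRegularity.NavierStokesRegularity.Theorems.AxisymmetricExtremalityAxisymmetricKatoGlobalReduction
import Summits.NavierStokesRegularity.NavierStokesRegularity.Theorems.AxisymmetricExtremalityAxisymmetricKatoGlobalStubSereginLogSwirlOrigin
import Summits.NavierStokesRegularity.NavierStokesRegularity.Theorems.AxisymmetricExtremalityAxisymmetricKatoGlobalSwirlAxisModulusBelow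
import Literature.Analysis.FluidPDE.AxisymmetricReflection
import HarnessLib

/-!
# Strategist census `s20-g24` (family `-s`, independent) — TYPED OBJECTS for the crux
# `AxisymmetricExtremality.AxisymmetricKatoGlobal` (stmt-NavierStokesRegularity-15453)

Crux workfile of the strategist seat `cstrat-stmt-NavierStokesRegularity-15453-s20-g24`
(planner, 2026-08-30).  NOT a line, NOT a Theorems file: every `def … : Prop` below is a
CENSUS OBJECT (a candidate weaker intermediate / split piece / strengthening, stated over tree
declarations), and every `theorem` is a sorry-free bookkeeping composition over LANDED tree
theorems.  Nothing here claims the crux.  The census text is `STRATEGY-CENSUS-s20-g24.md`.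

Sections: § W weaker intermediates that could replace the crux in `closes` (W₀ threshold
instance; W_{O(2)} the O(2)/swirl-free stratum — a THEOREM over the tree — and the dihedral
re-glue `closes_O2` it enables; W_bdd bounded swirl); § D decompositions (in-class threshold
split; the one-stub reduction of line `registered` now that both Seregin facts are discharged);
§ S/N typed strengthenings and the negation.
-/

set_option linter.dupNamespace false
set_option linter.unusedVariables false

noncomputable section

open MeasureTheory Set Function Filter Topology
open scoped ENNReal
open Literature.Analysis.FluidPDE Literature.Analysis.FunctionSpaces
open Summit.NavierStokesRegularity.NavierStokesRegularity.Theses.AxisymmetricExtremality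

namespace Summit.NavierStokesRegularity.NavierStokesRegularity.Cruxes.AxisymmetricKatoGlobal.StrategistS20g24

local notation "ℝ³" => EuclideanSpace ℝ (Fin 3)
local notation "ℂ³" => EuclideanSpace ℂ (Fin 3)

/-! ## § 0 Written-out symmetry clauses (verbatim the route's typing) -/

/-- Written-out `SO(2)`-equivariance about the `x 2`-axis, verbatim the crux's clause
(= `IsAxisymmetric u₀`, `Iff.rfl`). [folklore] -/
def AxisymW (u₀ : ℝ³ → ℝ³) : Prop :=
  ∀ (θ : ℝ) (x : ℝ³), u₀ (WithLp.toLp 2 ![Real.cos θ * x 0 - Real.sin θ * x 1, Real.sin θ * x 0 + Real.cos θ * x 1, x 2]) = WithLp.toLp 2 ![Real.cos θ * u₀ x 0 - Real.sin θ * u₀ x 1, Real.sin θ * u₀ x 0 + Real.cos θ * u₀ x 1, u₀ x 2]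

/-- The written-out clause is the tree's `IsAxisymmetric`, definitionally. [folklore] -/
theorem axisymW_iff (u₀ : ℝ³ → ℝ³) : AxisymW u₀ ↔ IsAxisymmetric u₀ := Iff.rfl

/-- Written-out equivariance under the meridian reflection `σ (x₀,x₁,x₂) = (x₀,−x₁,x₂)`:
`u₀ (σ x) = σ (u₀ x)` (= `∀ x, u₀ (reflY x) = reflY (u₀ x)`, `Iff.rfl`).  Together with `AxisymW`
this is `O(2)`-equivariance about the axis. [folklore] -/
def ReflW (u₀ : ℝ³ → ℝ³) : Prop :=
  ∀ x : ℝ³, u₀ (WithLp.toLp 2 ![x 0, -x 1, x 2]) = WithLp.toLp 2 ![u₀ x 0, -u₀ x 1, u₀ x 2]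

/-- The written-out reflection clause is conjugation-equivariance under the tree's `reflY`. [folklore] -/
theorem reflW_iff (u₀ : ℝ³ → ℝ³) : ReflW u₀ ↔ ∀ x, u₀ (reflY x) = reflY (u₀ x) := Iff.rfl

/-- `O(2)`-equivariant fields are swirl-free: `Γ = x₀u₁ − x₁u₀ ≡ 0` (Majda–Bertozzi §2.3.3; tree
`IsAxisymmetric.hasNoSwirl_of_reflY_eq`). [cite: MajdaBertozziCUP2002, §2.3.3] -/
theorem hasNoSwirl_of_axisymW_reflW {u₀ : ℝ³ → ℝ³} (hax : AxisymW u₀) (hσ : ReflW u₀) :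
    HasNoSwirl u₀ :=
  ((axisymW_iff u₀).1 hax).hasNoSwirl_of_reflY_eq ((reflW_iff u₀).1 hσ)

/-- Written-out `p`-fold equivariance (verbatim the clause of `MinimalDatumPFold`). [folklore] -/
def PFoldW (p : ℕ) (u₀ : ℝ³ → ℝ³) : Prop :=
  ∀ x : ℝ³, u₀ (WithLp.toLp 2 ![Real.cos (2 * Real.pi / p) * x 0 - Real.sin (2 * Real.pi / p) * x 1, Real.sin (2 * Real.pi / p) * x 0 + Real.cos (2 * Real.pi / p) * x 1, x 2]) = WithLp.toLp 2 ![Real.cos (2 * Real.pi / p) * u₀ x 0 - Real.sin (2 * Real.pi / p) * u₀ x 1, Real.sin (2 * Real.pi / p) * u₀ x 0 + Real.cos (2 * Real.pi / p) * u₀ x 1, u₀ x 2]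

/-- Clay (A) fails at viscosity `ν` (verbatim the antecedent of `MinimalDatumPFold`). [folklore] -/
def ClayFails (ν : ℝ) : Prop :=
  ∃ v₀ : ℝ³ → ℝ³, ContDiff ℝ (⊤ : ℕ∞) v₀ ∧ NSWave0.IsDivFree v₀ ∧ HasRapidSpatialDecay v₀ ∧
    ¬ ∃ (u : ℝ → ℝ³ → ℝ³) (p : ℝ → ℝ³ → ℝ), IsSmoothOnHalfSpace u ∧ IsSmoothOnHalfSpace p ∧
      IsNavierStokesSolution ν 0 v₀ u p ∧ HasBoundedEnergy u

/-- Sanity: the route's crux `MinimalDatumPFold` in these abbreviations (`Iff.rfl`). [folklore] -/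
theorem minimalDatumPFold_iff :
    MinimalDatumPFold ↔ ∀ ν : ℝ, 0 < ν → ClayFails ν → ∀ N : ℕ, ∃ p : ℕ, N ≤ p ∧ 2 ≤ p ∧
      ∃ (u₀ : ℝ³ → ℝ³) (g : HomSobolev ℝ³ ℂ³ (1 / 2 : ℝ)), IsMinimalBlowupDatum ν u₀ g ∧ PFoldW p u₀ :=
  Iff.rfl

/-- Sanity: the crux itself in these abbreviations (`Iff.rfl`). [folklore] -/
theorem crux_iff :
    AxisymmetricKatoGlobal ↔ ∀ ν : ℝ, 0 < ν → ∀ (u₀ : ℝ³ → ℝ³) (g : HomSobolev ℝ³ ℂ³ (1 / 2 : ℝ)),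
      MemLp u₀ 3 volume → g.Represents (Literature.Analysis.FunctionSpaces.EuclideanSpace.complexify ∘ u₀) →
      IsWeaklyDivFree u₀ → AxisymW u₀ → HasGlobalKatoSolution ν u₀ :=
  Iff.rfl

/-! ## § W  Strictly weaker intermediates that could replace the crux in `closes` -/

/-- **W₀ — the threshold instance** (the only instance `closes` consumes): there is no
axisymmetric Rusin–Šverák minimal blow-up datum.  OPEN; strictly weaker than the crux in form,
but no known tool converts `Ḣ^{1/2}`-minimality into Type-I / swirl-modulus control. [folklore] -/
def NoAxisymMinimalBlowup : Prop :=
  ∀ ν : ℝ, 0 < ν → ∀ (u₀ : ℝ³ → ℝ³) (g : HomSobolev ℝ³ ℂ³ (1 / 2 : ℝ)),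
    IsMinimalBlowupDatum ν u₀ g → AxisymW u₀ → False

/-- The crux implies its threshold instance. [folklore] -/
theorem noAxisymMinimalBlowup_of_crux (h : AxisymmetricKatoGlobal) : NoAxisymMinimalBlowup := by
  intro ν hν u₀ g hmin hax
  obtain ⟨hL3, hrep, hdiv, -, hnot⟩ := hmin
  exact hnot (h ν hν u₀ g hL3 hrep hdiv hax)

/-- **`closes` with the crux replaced by W₀** (pure logic, mirrors the route's `closes`): the
route needs only the threshold instance. [folklore] -/
theorem closes_threshold (h₂ : MinimalDatumPFold) (h₄ : PFoldToAxisymmetric)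
    (h₀ : NoAxisymMinimalBlowup) : NavierStokesRegularity := by
  show Literature.NS.NavierStokesExistenceSmoothR3
  intro ν hν u₀ hsm hdiv hdec
  by_contra hno
  obtain ⟨u₁, g, hmin, hax⟩ := h₄ ν hν (h₂ ν hν ⟨u₀, hsm, hdiv, hdec, hno⟩)
  exact h₀ ν hν u₁ g hmin hax

/-- **W_{O(2)} — the `O(2)` / swirl-free stratum of the crux**: every weakly divergence-free
`u₀ ∈ L³` (represented in `Ḣ^{1/2}`) that is axisymmetric AND meridian-reflection equivariant
(hence swirl-free) has a global Kato solution, every `ν > 0`. [folklore] -/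
def O2KatoGlobal : Prop :=
  ∀ ν : ℝ, 0 < ν → ∀ (u₀ : ℝ³ → ℝ³) (g : HomSobolev ℝ³ ℂ³ (1 / 2 : ℝ)),
    MemLp u₀ 3 volume → g.Represents (Literature.Analysis.FunctionSpaces.EuclideanSpace.complexify ∘ u₀) →
    IsWeaklyDivFree u₀ → AxisymW u₀ → ReflW u₀ → HasGlobalKatoSolution ν u₀

/-- **W_{O(2)} is a THEOREM over the tree** (Ladyzhenskaya 1968 / Ukhovskii–Yudovich 1968 in
Kato's critical class: `axisymmetricKatoGlobal_noSwirl_stratum`, landed, every `ν`). [cite: KNSS2009, §5 (swirl-free case); tree NoSwirlStratum] -/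
theorem o2KatoGlobal_holds : O2KatoGlobal := by
  intro ν hν u₀ g hL3 _hrep hdiv hax hσ
  exact Summit.NavierStokesRegularity.NavierStokesRegularity.Theorems.AxisymmetricKatoGlobal.NoSwirlStratum.axisymmetricKatoGlobal_noSwirl_stratum
    ν hν u₀ hL3 hdiv hax (hasNoSwirl_of_axisymW_reflW hax hσ)

/-- The crux implies its `O(2)` stratum (trivially). [folklore] -/
theorem o2KatoGlobal_of_crux (h : AxisymmetricKatoGlobal) : O2KatoGlobal :=
  fun ν hν u₀ g hL3 hrep hdiv hax _ => h ν hν u₀ g hL3 hrep hdiv hax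

/-- The `O(2)` threshold instance is likewise a THEOREM: no `O(2)`-equivariant minimal blow-up
datum exists (contrast: the `SO(2)` instance `NoAxisymMinimalBlowup` is open). [folklore] -/
theorem no_O2_minimalBlowupDatum (ν : ℝ) (hν : 0 < ν) (u₀ : ℝ³ → ℝ³)
    (g : HomSobolev ℝ³ ℂ³ (1 / 2 : ℝ)) (hmin : IsMinimalBlowupDatum ν u₀ g) (hax : AxisymW u₀)
    (hσ : ReflW u₀) : False := by
  obtain ⟨hL3, hrep, hdiv, -, hnot⟩ := hmin
  exact hnot (o2KatoGlobal_holds ν hν u₀ g hL3 hrep hdiv hax hσ)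

/-- **Strengthened extremality crux (route-level re-glue, for the tenure planner — NOT an item of
this crux):** Clay failure at `ν` ⇒ DIHEDRALLY symmetric minimal blow-up data (`p`-fold AND
meridian-reflection equivariant) for unboundedly many `p`.  Smith theory for the 2-groups
`D_{2^k}` on an `F₂`-acyclic `M̂`, in place of `Z_p` on an `F_p`-acyclic `M̂`. [folklore] -/
def MinimalDatumDihedral : Prop :=
  ∀ ν : ℝ, 0 < ν → ClayFails ν → ∀ N : ℕ, ∃ p : ℕ, N ≤ p ∧ 2 ≤ p ∧
    ∃ (u₀ : ℝ³ → ℝ³) (g : HomSobolev ℝ³ ℂ³ (1 / 2 : ℝ)),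
      IsMinimalBlowupDatum ν u₀ g ∧ PFoldW p u₀ ∧ ReflW u₀

/-- **Compactness upgrade with the reflection carried along** (the proved `PFoldToAxisymmetric`
plus closedness of reflection-equivariance under modulated `L³` limits; M-size). [folklore] -/
def DihedralToO2 : Prop :=
  ∀ ν : ℝ, 0 < ν →
    (∀ N : ℕ, ∃ p : ℕ, N ≤ p ∧ 2 ≤ p ∧ ∃ (u₀ : ℝ³ → ℝ³) (g : HomSobolev ℝ³ ℂ³ (1 / 2 : ℝ)),
      IsMinimalBlowupDatum ν u₀ g ∧ PFoldW p u₀ ∧ ReflW u₀) →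
    ∃ (u₀ : ℝ³ → ℝ³) (g : HomSobolev ℝ³ ℂ³ (1 / 2 : ℝ)),
      IsMinimalBlowupDatum ν u₀ g ∧ AxisymW u₀ ∧ ReflW u₀

/-- The dihedral crux trivially implies the route's `MinimalDatumPFold`. [folklore] -/
theorem minimalDatumPFold_of_dihedral (h : MinimalDatumDihedral) : MinimalDatumPFold := by
  intro ν hν hfail N
  obtain ⟨p, hNp, h2p, u₀, g, hmin, hpf, -⟩ := h ν hν hfail N
  exact ⟨p, hNp, h2p, u₀, g, hmin, hpf⟩

/-- **THE RE-GLUE `closes_O2` — kernel-checked, sorry-free over the tree: with dihedral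
extremality the crux `AxisymmetricKatoGlobal` LEAVES THE CONE** (its `O(2)` stratum, a theorem,
is all that is consumed). [folklore] -/
theorem closes_O2 (h₂ : MinimalDatumDihedral) (h₄ : DihedralToO2) : NavierStokesRegularity := by
  show Literature.NS.NavierStokesExistenceSmoothR3
  intro ν hν u₀ hsm hdiv hdec
  by_contra hno
  obtain ⟨u₁, g, hmin, hax, hσ⟩ := h₄ ν hν (h₂ ν hν ⟨u₀, hsm, hdiv, hdec, hno⟩)
  exact no_O2_minimalBlowupDatum ν hν u₁ g hmin hax hσ

/-- Vacuity (as for `MinimalDatumPFold`, cf. tree `cruxBody_of_navierStokesRegularity`): under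
the summit the dihedral crux holds because its antecedent is unsatisfiable. [folklore] -/
theorem minimalDatumDihedral_of_summit (hS : NavierStokesRegularity) : MinimalDatumDihedral := by
  intro ν hν hfail
  obtain ⟨v₀, hsm, hdiv, hdec, hno⟩ := hfail
  have hS' : Literature.NS.NavierStokesExistenceSmoothR3 := hS
  exact absurd (hS' ν hν v₀ hsm hdiv hdec) hno

/-- Hence, given the (M-size) upgrade `DihedralToO2`, the re-glued route's single open crux is
EQUIVALENT to the summit over the tree — the re-glue relocates Clay (A) into the topological
crux; it removes the open PDE problem from the cone but creates no leverage by itself. [folklore] -/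
theorem minimalDatumDihedral_iff_summit (h₄ : DihedralToO2) :
    MinimalDatumDihedral ↔ NavierStokesRegularity :=
  ⟨fun h₂ => closes_O2 h₂ h₄, minimalDatumDihedral_of_summit⟩

/-- **W_bdd — bounded-swirl instance** (`Γ₀ = x₀u₁ − x₁u₀ ∈ L^∞`; = Ladyzhenskaya's
axisymmetric-with-swirl problem ns.S25 in Kato form).  OPEN (the open problem proper); and NOT
consumable by `closes` without an extra lemma "minimal data may be taken with bounded swirl",
itself unknown. [cite: KNSS2009, §1 (Γ bounded by the maximum principle)] -/
def AxisymKatoGlobalBoundedSwirl : Prop :=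
  ∀ ν : ℝ, 0 < ν → ∀ (u₀ : ℝ³ → ℝ³) (g : HomSobolev ℝ³ ℂ³ (1 / 2 : ℝ)),
    MemLp u₀ 3 volume → g.Represents (Literature.Analysis.FunctionSpaces.EuclideanSpace.complexify ∘ u₀) →
    IsWeaklyDivFree u₀ → AxisymW u₀ → (∃ M : ℝ, ∀ x, |swirl u₀ x| ≤ M) → HasGlobalKatoSolution ν u₀

/-- The crux implies its bounded-swirl instance (trivially). [folklore] -/
theorem boundedSwirl_of_crux (h : AxisymmetricKatoGlobal) : AxisymKatoGlobalBoundedSwirl :=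
  fun ν hν u₀ g hL3 hrep hdiv hax _ => h ν hν u₀ g hL3 hrep hdiv hax

/-! ## § D  Decompositions -/

/-- An admissible axisymmetric datum WITHOUT a global Kato solution ("bad datum"). [folklore] -/
def IsBadAxisymDatum (ν : ℝ) (u₀ : ℝ³ → ℝ³) (g : HomSobolev ℝ³ ℂ³ (1 / 2 : ℝ)) : Prop :=
  MemLp u₀ 3 volume ∧ g.Represents (Literature.Analysis.FunctionSpaces.EuclideanSpace.complexify ∘ u₀) ∧
    IsWeaklyDivFree u₀ ∧ AxisymW u₀ ∧ ¬ HasGlobalKatoSolution ν u₀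

/-- **D1, piece Sub₁ — the in-class threshold is attained**: if some axisymmetric admissible
datum is bad at `ν`, one of least `Ḣ^{1/2}`-norm is (profile decomposition / Rusin–Šverák run
inside the closed, flow-invariant axisymmetric class with axial translations; provable-type,
L-size, NOT in the tree). [cite: RusinSverak2011, Cor 4.3 (method, inside the symmetric class)] -/
def AxisymThresholdAttained : Prop :=
  ∀ ν : ℝ, 0 < ν → (∃ (u₀ : ℝ³ → ℝ³) (g : HomSobolev ℝ³ ℂ³ (1 / 2 : ℝ)), IsBadAxisymDatum ν u₀ g) →
    ∃ (u₀ : ℝ³ → ℝ³) (g : HomSobolev ℝ³ ℂ³ (1 / 2 : ℝ)), IsBadAxisymDatum ν u₀ g ∧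
      ∀ (u₁ : ℝ³ → ℝ³) (g₁ : HomSobolev ℝ³ ℂ³ (1 / 2 : ℝ)), IsBadAxisymDatum ν u₁ g₁ → ‖g‖ₑ ≤ ‖g₁‖ₑ

/-- **D1, piece Sub₂ — no in-class minimiser**: every bad axisymmetric datum is undercut by a
strictly cheaper bad axisymmetric datum.  OPEN — and, modulo Sub₁, EQUIVALENT to the crux
(`crux_of_thresholdSplit` / `noAxisymClassMinimiser_of_crux`): the split has no leverage. [folklore] -/
def NoAxisymClassMinimiser : Prop :=
  ∀ ν : ℝ, 0 < ν → ∀ (u₀ : ℝ³ → ℝ³) (g : HomSobolev ℝ³ ℂ³ (1 / 2 : ℝ)), IsBadAxisymDatum ν u₀ g →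
    ∃ (u₁ : ℝ³ → ℝ³) (g₁ : HomSobolev ℝ³ ℂ³ (1 / 2 : ℝ)), IsBadAxisymDatum ν u₁ g₁ ∧ ‖g₁‖ₑ < ‖g‖ₑ

/-- D1 assembly, PROVED (pure logic): Sub₁ → Sub₂ → crux. [folklore] -/
theorem crux_of_thresholdSplit (h₁ : AxisymThresholdAttained) (h₂ : NoAxisymClassMinimiser) :
    AxisymmetricKatoGlobal := by
  intro ν hν u₀ g hL3 hrep hdiv hax
  by_contra hng
  obtain ⟨u₁, g₁, hbad, hmin⟩ := h₁ ν hν ⟨u₀, g, hL3, hrep, hdiv, hax, hng⟩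
  obtain ⟨u₂, g₂, hbad₂, hlt⟩ := h₂ ν hν u₁ g₁ hbad
  exact absurd (hmin u₂ g₂ hbad₂) (not_le.2 hlt)

/-- D1 honesty check: Sub₂ is implied by the crux (vacuously), so Sub₂ ↔ crux modulo Sub₁. [folklore] -/
theorem noAxisymClassMinimiser_of_crux (h : AxisymmetricKatoGlobal) : NoAxisymClassMinimiser := by
  intro ν hν u₀ g hbad
  exact absurd (h ν hν u₀ g hbad.1 hbad.2.1 hbad.2.2.1 hbad.2.2.2.1) hbad.2.2.2.2

/-- **D3 — the best reduction the tree already holds (line `registered`)**: the log³ axis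
modulus of the swirl UP TO the final time of an axisymmetric Kato solution (verbatim the
registered stub `stub_swirlAxisModulus`). [cite: LeiZhang2011, Thm 1.1; Seregin2022 §2] -/
def SwirlAxisModulusToTmax : Prop :=
  ∀ ν : ℝ, 0 < ν → ∀ T : ℝ, 0 < T → ∀ (u₀ : ℝ³ → ℝ³) (g : HomSobolev ℝ³ ℂ³ (1 / 2 : ℝ))
    (u : ℝ → ℝ³ → ℝ³), g.Represents (Literature.Analysis.FunctionSpaces.EuclideanSpace.complexify ∘ u₀) →
    IsKatoSolutionOn T ν u₀ u → ContDiffOn ℝ (⊤ : ℕ∞) (uncurry u) (Ioo 0 T ×ˢ univ) →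
    (∀ t ∈ Ioo 0 T, IsAxisymmetric (u t)) →
    ∀ t₀ ∈ Ioo 0 T, ∃ C δ₀ : ℝ, 0 < δ₀ ∧ δ₀ < 1 ∧
      ∀ t ∈ Ico t₀ T, ∀ x : ℝ³, cylRadius x ≤ δ₀ → |swirl (u t) x| ≤ C / |Real.log (cylRadius x)| ^ 3

/-- **Over the CURRENT tree the crux follows from this ONE a-priori estimate, unconditionally**:
both named facts of line `registered` are discharged (`seregin2022_logSwirl_regularAtOrigin_holds`,
Seregin 2022; the capstone `AxisymmetricKatoGlobal_of_logSwirlFacts`, p150628).  The estimate is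
known below `T_max` (`swirlAxisModulus_of_lt`) and under Type-I control only; at `T_max` it is the
open a-priori estimate of the axisymmetric-with-swirl problem. [cite: Seregin2022, §2; LeiZhang2011, Thm 1.1] -/
theorem crux_of_swirlAxisModulus (h : SwirlAxisModulusToTmax) : AxisymmetricKatoGlobal :=
  Summit.NavierStokesRegularity.NavierStokesRegularity.Theorems.AxisymmetricKatoGlobal.Registered.AxisymmetricKatoGlobal_of_logSwirlFacts
    Summit.NavierStokesRegularity.NavierStokesRegularity.Theorems.AxisymmetricKatoGlobal.EulerScaling.seregin2022_logSwirl_regularAtOrigin_holds h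

/-! ## § S / § N  Typed strengthenings and the negation -/

/-- **S2 — a-priori critical bound in the class** (the quantitative strengthening): along every
axisymmetric Kato solution on `[0,T)` the `L³` norm stays bounded.  Implies the crux by the
Escauriaza–Seregin–Šverák / Seregin 2012 `L³` blow-up criterion; it IS the supercriticality
barrier (`Literature.Barriers.NavierStokesRegularity.EnergySupercriticality`) restricted to the
class — no a-priori critical quantity other than `‖Γ‖_∞` is known there. [cite: KNSS2009, §1; arXiv:2101.04905 p. 6] -/
def AxisymAprioriL3Bound : Prop :=
  ∀ ν : ℝ, 0 < ν → ∀ T : ℝ, 0 < T → ∀ (u₀ : ℝ³ → ℝ³) (u : ℝ → ℝ³ → ℝ³),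
    IsKatoSolutionOn T ν u₀ u → (∀ t ∈ Ioo 0 T, IsAxisymmetric (u t)) →
    ∃ M : ℝ≥0∞, M < ∞ ∧ ∀ t ∈ Ico 0 T, eLpNorm (u t) 3 volume ≤ M

/-- **N — the negation of the crux** (what a counterexample must be): an axisymmetric admissible
critical datum without a global Kato solution, i.e. finite-time blow-up for axisymmetric
Navier–Stokes with swirl; by the class barriers it must be Type II and not (discretely)
self-similar; the only candidate is numerical (Hou, arXiv:2107.06509). [cite: arXiv:2107.06509, §1] -/
def CruxNegation : Prop :=
  ∃ ν : ℝ, 0 < ν ∧ ∃ (u₀ : ℝ³ → ℝ³) (g : HomSobolev ℝ³ ℂ³ (1 / 2 : ℝ)), IsBadAxisymDatum ν u₀ g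

/-- The negation object is literally `¬ crux`. [folklore] -/
theorem cruxNegation_iff : CruxNegation ↔ ¬ AxisymmetricKatoGlobal := by
  constructor
  · rintro ⟨ν, hν, u₀, g, hL3, hrep, hdiv, hax, hbad⟩ h
    exact hbad (h ν hν u₀ g hL3 hrep hdiv hax)
  · intro h
    by_contra hne
    apply h
    intro ν hν u₀ g hL3 hrep hdiv hax
    by_contra hbad
    exact hne ⟨ν, hν, u₀, g, hL3, hrep, hdiv, hax, hbad⟩

end Summit.NavierStokesRegularity.NavierStokesRegularity.Cruxes.AxisymmetricKatoGlobal.StrategistS20g24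

end
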